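import Summits.HodgeConjecture.HodgeConjecture.Theorems.F0P3SpectralPacketUnitarizableByOccurrence  -- ★ `cmOccursInDiscreteSpectrum`
import Literature.NumberTheory.Rogawski1990.CMLocalAPacketMembers                                  -- ★ `Gqs`, ★ `qsForm`
import HarnessLib

/-!
# `K2E1RigidityFiniteU3ParityObstruction` — the socket `sig_K2E1RigidityFiniteU3` (as typed) is incompatible with a parity-closed
# infinite family of occurring members (Rogawski's A-packets `Π(ξ)`)

Track B ∕ K2-LIT, crux h413 = `stmt-HodgeConjecture-24833`, route of record `HCCMUnconditional`; prover seat `hodgecm-mathlib-K2E1-p08` (g0);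
lane `--supports stmt-HodgeConjecture-24833` (count-neutral).  THEOREMS ONLY (no `def`, no `instance`, no notation, no named-fact hypothesis, no `sorry`).
Socket audited: `sig_K2E1RigidityFiniteU3` of `Cruxes/H413/Lines/K2_E1_TraceFormulaBetaSigs_GlobalIndex.lean` (ED. 2, :180), whose conclusion is
`{π' | cmOccursInDiscreteSpectrum L 3 (qsForm L) μ π' ∧ ∀ᶠ u in Filter.cofinite, π' u = π u}.Finite` for EVERY occurring family `π` of the quasi-split `U(3)`.

**What is proved (kernel-checked, elementary).**  `infinite_cofiniteFibre_of_parityClosedFamily`: if over one CM field `L` and one automorphic measure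
`μ` there are two families of local classes `πⁿ, πˢ` of `U(Φ₃)(L⁺_u)` that DIFFER on an infinite set `T` of finite places, and every family equal to `πˢ`
on a finite `S ⊆ T` of a fixed parity and to `πⁿ` elsewhere OCCURS in the discrete spectrum (★ `cmOccursInDiscreteSpectrum`), then for the occurring
member `π_{S₀}` the set of occurring `π'` with `π' u = π_{S₀} u` for cofinitely many `u` is INFINITE (it contains the pairwise distinct `π_S`, `S ⊆ T` of
the admissible parity, `Card S` unbounded).  `not_sig_K2E1RigidityFiniteU3_of_parityClosedFamily`: hence such a family REFUTES the socket's statement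
(its type pasted verbatim, the reducible abbrev `Pl L = HeightOneSpectrum (𝓞 L⁺)` of the organ inlined).

**Why print supplies the hypothesis (not formalised here — it is the engine E1 itself).**  For a one-dimensional automorphic `ξ` of `H = U(2) × U(1)`
(e.g. `ξ = 1`) the A-packet is `Π(ξ) = ⊗_v Π(ξ_v)` with «`Π(ξ) = {πⁿ(ξ), πˢ(ξ)}`» at every place `v` of `L⁺` NOT split in `L`, `πˢ(ξ_v)` supercuspidal
[Rogawski1990, §13.1 p. 199 l. 6; Prop. 13.1.3 (d)], a singleton at split `v`; by THEOREM 13.3.7 [p. 203] with `Card(Π̂) = 2`, `⟨ξ, π⟩ = 1`,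
`⟨1, πⁿ⟩ = 1`, `⟨1, πˢ⟩ = −1` [§13.2 p. 200 l. 1] the multiplicity is `m(π) = ½(1 + (−1)^{n(π)})`, `n(π) = Card{v : π_v = πˢ(ξ_v)}` (the root-number
correction of [Rogawski1992, Thm. 1.1] replaces `(−1)^{n(π)}` by `ε · (−1)^{n(π)}` for a sign `ε = ε(½, φ)` depending on `ξ` only — a PARITY condition
either way); the occurring members are cuspidal unless `n(π) = 0` [Thm. 13.3.6 (a)(b) p. 202].  Holding the archimedean components at `πⁿ`, the finite-place
families `π_S` (`πˢ` on `S`, `πⁿ` off `S`) occur for every finite set `S` of INERT finite places of one parity; inert places are infinite (Chebotarev).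
So `T` = the inert finite places, `πⁿ_u = πⁿ(ξ_u)`, `πˢ_u = πˢ(ξ_u)` satisfy the hypothesis, and the socket is false in print.  The docstring's gloss «they lie
in the global packet of `π`, whose local packets are singletons off a finite set» holds for `Π ∈ Π_e(G) ∪ Π_s(G)`, not for `Π ∈ Π_a(G)`.

**What survives (for the dealer's re-cut; not stated here).**  The UNIFORM shape — a FIXED exceptional finite set `S`, as in the tier-0 law
`StGlobKit.LawFibreFinite v` (`S = {v}`) — «only finitely many occurring `π'` with `π' u = π u` for all `u ∉ S`» is true in print (Thm. 13.3.5 rigidity of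
packets + Thm. 13.3.6 (c) + `Card Π_v ≤ 4`, Prop. 13.1.2 (a) + «each representation lies in at most one packet unless `π = πˢ(ξ)`», p. 199).

HONEST LABEL: HC_CM is proved only modulo the 7 printed citations (2 remaining named inputs: hLiu418 = `stmt-HodgeConjecture-24832`, h413 =
`stmt-HodgeConjecture-24833`) until rung 0 closes; this file proves no printed statement and moves no counter — it certifies an obstruction to one socket.

## References
* [Rogawski1990] J. D. Rogawski, *Automorphic Representations of Unitary Groups in Three Variables*, Ann. of Math. Stud. 123 (1990): §13.1 p. 199
  (A-packets `Π(ξ)`, Prop. 13.1.2 (a), Prop. 13.1.3 (d)); §13.2 p. 200 (`⟨1, πⁿ⟩ = 1`, `⟨1, πˢ⟩ = −1`); §13.3 Thms. 13.3.5, 13.3.6, 13.3.7 pp. 202–203.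
* [Rogawski1992] J. D. Rogawski, *The multiplicity formula for A-packets*, in: The zeta functions of Picard modular surfaces, CRM Montréal (1992), Thm. 1.1.
-/

set_option autoImplicit false
-- the mandated namespace repeats the single-problem summit's segment (`HodgeConjecture.HodgeConjecture`)
set_option linter.dupNamespace false

noncomputable section

open NumberField IsDedekindDomain MeasureTheory Filter
open Literature.NumberTheory.Rogawski1990 Literature.NumberTheory.Automorphic Literature.NumberTheory.Automorphic.UnitaryGroup
open Summit.HodgeConjecture.HodgeConjecture.Cruxes.H413.F0P3GlobalPacketDiscrete (cmOccursInDiscreteSpectrum)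

namespace Summit.HodgeConjecture.HodgeConjecture.Cruxes.H413.K2E1RigidityFiniteU3ParityObstruction

variable {L : Type} [Field L] [NumberField L] [IsCMField L]

/-- Two families that agree off the finite set `↑S ∪ ↑S₀` agree cofinitely (Mathlib `Filter.eventually_cofinite`). [folklore] -/
theorem eventually_cofinite_eq_of_subset {α : Type*} {β : α → Type*} (f g : ∀ a, β a) (F : Finset α)
    (h : ∀ a, a ∉ F → f a = g a) : ∀ᶠ a in Filter.cofinite, f a = g a := by
  rw [Filter.eventually_cofinite]
  exact (F.finite_toSet).subset (fun a ha => by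
    by_contra haF
    exact ha (h a haF))

/-- **The parity-closed family of members `π_S` (`πˢ` on `S`, `πⁿ` off `S`) is injective in `S ⊆ T` when `πˢ ≠ πⁿ` on `T`.** [folklore] -/
theorem piecewise_injective {α : Type*} {β : α → Type*} [DecidableEq α] (T : Set α) (πn πs : ∀ a, β a)
    (hne : ∀ a ∈ T, πs a ≠ πn a) {S S' : Finset α} (hS : (↑S : Set α) ⊆ T) (hS' : (↑S' : Set α) ⊆ T)
    (h : (fun a => if a ∈ S then πs a else πn a) = fun a => if a ∈ S' then πs a else πn a) : S = S' := by
  ext a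
  have ha : (if a ∈ S then πs a else πn a) = if a ∈ S' then πs a else πn a := congrFun h a
  by_cases h1 : a ∈ S <;> by_cases h2 : a ∈ S'
  · exact ⟨fun _ => h2, fun _ => h1⟩
  · rw [if_pos h1, if_neg h2] at ha
    exact absurd ha (hne a (hS (Finset.mem_coe.mpr h1)))
  · rw [if_neg h1, if_pos h2] at ha
    exact absurd ha.symm (hne a (hS' (Finset.mem_coe.mpr h2)))
  · exact ⟨fun h => absurd h h1, fun h => absurd h h2⟩

/-- **OBSTRUCTION.** Over one CM field `L` and one automorphic measure `μ` on `U(Φ₃)(L⁺)\U(Φ₃)(𝔸_{L⁺})`: if two families of local classes `πⁿ, πˢ` of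
`U(Φ₃)(L⁺_u)` differ on an INFINITE set `T` of finite places of `L⁺` and every family equal to `πˢ` on a finite `S ⊆ T` with `Card S ≡ p (mod 2)` and to
`πⁿ` elsewhere occurs in the discrete spectrum (Rogawski's A-packet `Π(ξ)`: `T` = inert places, Thm. 13.3.7), then some occurring `π` has INFINITELY many
occurring `π'` agreeing with it at cofinitely many places — the members `π_S`, `S ⊆ T` of the admissible parity, pairwise distinct with `Card S` unbounded.
[cite: Rogawski1990, §13.1 p. 199; §13.3 Thm. 13.3.7 p. 203; Thm. 13.3.6 (a)(b) p. 202] [cite: Rogawski1992, Thm. 1.1] -/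
theorem infinite_cofiniteFibre_of_parityClosedFamily
    (μ : Measure (adelicGroupData (↥(maximalRealSubfield L)) L (IsCMField.complexConj L) 3 (qsForm L)).automorphicQuotient)
    [(adelicGroupData (↥(maximalRealSubfield L)) L (IsCMField.complexConj L) 3 (qsForm L)).IsAutomorphicMeasure μ]
    (T : Set (HeightOneSpectrum (𝓞 ↥(maximalRealSubfield L)))) (hT : T.Infinite)
    (πn πs : ∀ u : HeightOneSpectrum (𝓞 ↥(maximalRealSubfield L)), IrrClass (Gqs L u)) (hne : ∀ u ∈ T, πs u ≠ πn u) (p : ℕ)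
    (hocc : ∀ S : Finset (HeightOneSpectrum (𝓞 ↥(maximalRealSubfield L))), (↑S : Set _) ⊆ T → S.card % 2 = p % 2 →
      ∀ π' : ∀ u : HeightOneSpectrum (𝓞 ↥(maximalRealSubfield L)), IrrClass (Gqs L u),
        (∀ u, u ∈ S → π' u = πs u) → (∀ u, u ∉ S → π' u = πn u) → cmOccursInDiscreteSpectrum L 3 (qsForm L) μ π') :
    ∃ π : ∀ u : HeightOneSpectrum (𝓞 ↥(maximalRealSubfield L)), IrrClass (Gqs L u),
      cmOccursInDiscreteSpectrum L 3 (qsForm L) μ π ∧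
        {π' : ∀ u : HeightOneSpectrum (𝓞 ↥(maximalRealSubfield L)), IrrClass (Gqs L u) |
          cmOccursInDiscreteSpectrum L 3 (qsForm L) μ π' ∧ ∀ᶠ u in Filter.cofinite, π' u = π u}.Infinite := by
  classical
  -- the members `π_S`
  let fam : Finset (HeightOneSpectrum (𝓞 ↥(maximalRealSubfield L))) →
      ∀ u : HeightOneSpectrum (𝓞 ↥(maximalRealSubfield L)), IrrClass (Gqs L u) :=
    fun S u => if u ∈ S then πs u else πn u
  have hfam_occ : ∀ S : Finset (HeightOneSpectrum (𝓞 ↥(maximalRealSubfield L))), (↑S : Set _) ⊆ T → S.card % 2 = p % 2 →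
      cmOccursInDiscreteSpectrum L 3 (qsForm L) μ (fam S) :=
    fun S hS hp => hocc S hS hp (fam S) (fun u hu => if_pos hu) (fun u hu => if_neg hu)
  -- subsets of `T` of every size (T infinite)
  have hsub : ∀ n : ℕ, ∃ S : Finset (HeightOneSpectrum (𝓞 ↥(maximalRealSubfield L))), (↑S : Set _) ⊆ T ∧ S.card = n :=
    fun n => hT.exists_subset_card_eq n
  choose Sof hSofT hSofcard using hsub
  -- the base member: `Card S₀ = p % 2`
  refine ⟨fam (Sof (p % 2)), hfam_occ _ (hSofT _) (by rw [hSofcard]; omega), ?_⟩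
  -- the injective sequence `k ↦ π_{S(2k + p % 2)}` lies in the fibre set
  refine Set.infinite_of_injective_forall_mem (f := fun k : ℕ => fam (Sof (2 * k + p % 2))) ?_ ?_
  · intro k k' hkk'
    have hS : Sof (2 * k + p % 2) = Sof (2 * k' + p % 2) :=
      piecewise_injective T πn πs hne (hSofT _) (hSofT _) hkk'
    have hc := congrArg Finset.card hS
    rw [hSofcard, hSofcard] at hc
    omega
  · intro k
    refine ⟨hfam_occ _ (hSofT _) (by rw [hSofcard]; omega), ?_⟩
    refine eventually_cofinite_eq_of_subset _ _ (Sof (2 * k + p % 2) ∪ Sof (p % 2)) (fun u hu => ?_)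
    rw [Finset.mem_union, not_or] at hu
    show (if u ∈ Sof (2 * k + p % 2) then πs u else πn u) = if u ∈ Sof (p % 2) then πs u else πn u
    rw [if_neg hu.1, if_neg hu.2]

/-- **THE SOCKET `sig_K2E1RigidityFiniteU3` AS TYPED IS REFUTED BY ANY PARITY-CLOSED INFINITE FAMILY OF OCCURRING MEMBERS** — in particular by Rogawski's
A-packets `Π(ξ)` (`T` = the inert finite places of `L⁺`, `πⁿ_u = πⁿ(ξ_u)`, `πˢ_u = πˢ(ξ_u)` supercuspidal, multiplicity `½(1 ± (−1)^{n(π)})`, Thm. 13.3.7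
∕ [Rogawski1992]).  The negated statement is the socket's type verbatim (`Cruxes/H413/Lines/K2_E1_TraceFormulaBetaSigs_GlobalIndex.lean` ED. 2 :180),
with the organ's reducible abbrev `Pl L := HeightOneSpectrum (𝓞 L⁺)` inlined.
[cite: Rogawski1990, §13.1 p. 199; §13.3 Thm. 13.3.7 p. 203; Thm. 13.3.6 p. 202] [cite: Rogawski1992, Thm. 1.1] -/
theorem not_sig_K2E1RigidityFiniteU3_of_parityClosedFamily
    (μ : Measure (adelicGroupData (↥(maximalRealSubfield L)) L (IsCMField.complexConj L) 3 (qsForm L)).automorphicQuotient)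
    [(adelicGroupData (↥(maximalRealSubfield L)) L (IsCMField.complexConj L) 3 (qsForm L)).IsAutomorphicMeasure μ]
    (T : Set (HeightOneSpectrum (𝓞 ↥(maximalRealSubfield L)))) (hT : T.Infinite)
    (πn πs : ∀ u : HeightOneSpectrum (𝓞 ↥(maximalRealSubfield L)), IrrClass (Gqs L u)) (hne : ∀ u ∈ T, πs u ≠ πn u) (p : ℕ)
    (hocc : ∀ S : Finset (HeightOneSpectrum (𝓞 ↥(maximalRealSubfield L))), (↑S : Set _) ⊆ T → S.card % 2 = p % 2 →
      ∀ π' : ∀ u : HeightOneSpectrum (𝓞 ↥(maximalRealSubfield L)), IrrClass (Gqs L u),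
        (∀ u, u ∈ S → π' u = πs u) → (∀ u, u ∉ S → π' u = πn u) → cmOccursInDiscreteSpectrum L 3 (qsForm L) μ π') :
    ¬ (∀ (L : Type) [Field L] [NumberField L] [IsCMField L]
        (μ : Measure (adelicGroupData (↥(maximalRealSubfield L)) L (IsCMField.complexConj L) 3 (qsForm L)).automorphicQuotient)
        [(adelicGroupData (↥(maximalRealSubfield L)) L (IsCMField.complexConj L) 3 (qsForm L)).IsAutomorphicMeasure μ]
        (π : ∀ u : HeightOneSpectrum (𝓞 ↥(maximalRealSubfield L)), IrrClass (Gqs L u)), cmOccursInDiscreteSpectrum L 3 (qsForm L) μ π →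
        {π' : ∀ u : HeightOneSpectrum (𝓞 ↥(maximalRealSubfield L)), IrrClass (Gqs L u) |
          cmOccursInDiscreteSpectrum L 3 (qsForm L) μ π' ∧ ∀ᶠ u in Filter.cofinite, π' u = π u}.Finite) := by
  intro hsig
  obtain ⟨π, hπ, hinf⟩ := infinite_cofiniteFibre_of_parityClosedFamily μ T hT πn πs hne p hocc
  exact hinf (hsig L μ π hπ)

end Summit.HodgeConjecture.HodgeConjecture.Cruxes.H413.K2E1RigidityFiniteU3ParityObstruction

end
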